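import Mathlib
import Literature.Geometry.Lorentzian.ReggeWheelerTortoise
import Literature.Geometry.Lorentzian.ReggeWheelerChannels

/-!
# Route PhotonSphereChannels — frozen velocity packets, I: profiles and the potential on a layer

Support file for the refutation of K1 `UniformPhotonSphereChannels` (stmt-FinalStateConjecture-10045) by
FROZEN VELOCITY PACKETS (the mechanism isolated by prover seat 3 in
`PhotonSphereChannelsFrozenPacketAnsatz.lean`): odd data `(0, g)` with `g` a bump in a thin layer of
width `w` just inside the near edge `xe` of the exterior cone; for `ℓ → ∞` with `ℓ³`-versus-`w⁻²`
scaling the solution does not move during the time `T = 2w` it takes the receding edge `xe − t` to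
uncover the layer, so both finite-time exterior energies are `o(∫ g²)` while the kernel deficit stays
`≥ ∫ g²`.  This settles K2 `ChannelsResolveTameDevelopments` (stmt-FinalStateConjecture-10046) = `K1 → Φ`
ex falso.  Here: the ingredients that do not involve the wave equation.

* `exists_unit_bump` — a `C²` bump `G` supported in `[−1, 1]` with sup bounds on `G`, `G''` and
  `0 < ∫ G²`;
* `scaled_profile` — `g(x) = G(κ(x − x₁))`: support, sup bounds `|g| ≤ A₀`, `|g''| ≤ κ²A₂`,
  `∫ g² = κ⁻¹ ∫ G²`;
* `linePotential_one_one_eq` — at `M = 1`, `s = 1`: `V_{1,ℓ}(r x) = ℓ(ℓ+1) · f(x)`,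
  `f = (1 − 2/r)/r²` independent of `ℓ`; `shape_pos`: `f > 0`;
  `shape_layer_bounds(_of)` — on a compact layer `[a, b]`: `f ≥ f₀ > 0` and `|f x − f y| ≤ K|x − y|`.

No definitions. [folklore]
-/

noncomputable section

open Set Filter MeasureTheory Topology Function

namespace Summit.FinalStateConjecture.FinalStateConjecture.Theorems.FrozenEscape

/-! ### A unit bump with sup bounds -/

/-- **A `C²` unit bump** supported in `[−1, 1]`, with sup bounds on itself and its second
derivative, square-integrable with positive `L²` mass. -/
theorem exists_unit_bump : ∃ G : ℝ → ℝ, ContDiff ℝ 2 G ∧ (∀ x, (x ≤ -1 ∨ 1 ≤ x) → G x = 0) ∧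
    (∃ A₀ : ℝ, 0 ≤ A₀ ∧ ∀ x, |G x| ≤ A₀) ∧ (∃ A₂ : ℝ, 0 ≤ A₂ ∧ ∀ x, |iteratedDeriv 2 G x| ≤ A₂) ∧
    Integrable (fun x => G x ^ 2) ∧ 0 < ∫ x, G x ^ 2 := by
  let G : ℝ → ℝ := fun x => expNegInvGlue (x + 1) * expNegInvGlue (1 - x)
  have hG_def : ∀ x, G x = expNegInvGlue (x + 1) * expNegInvGlue (1 - x) := fun x => rfl
  have hG0 : ∀ x, (x ≤ -1 ∨ 1 ≤ x) → G x = 0 := by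
    intro x hx
    rcases hx with h | h
    · rw [hG_def, expNegInvGlue.zero_of_nonpos (by linarith), zero_mul]
    · rw [hG_def, expNegInvGlue.zero_of_nonpos (by linarith : 1 - x ≤ 0), mul_zero]
  have hGn : ∀ n : ℕ∞, ContDiff ℝ n G := fun n =>
    ((expNegInvGlue.contDiff (n := n)).comp (contDiff_id.add contDiff_const)).mul
      ((expNegInvGlue.contDiff (n := n)).comp (contDiff_const.sub contDiff_id))
  have hG2 : ContDiff ℝ 2 G := hGn 2
  have hGc : Continuous G := hG2.continuous
  have hGsupp : HasCompactSupport G := by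
    refine HasCompactSupport.intro (isCompact_Icc (a := -1) (b := 1)) fun x hx => ?_
    apply hG0
    by_contra hcon
    simp only [not_or, not_le] at hcon
    exact hx ⟨hcon.1.le, hcon.2.le⟩
  -- sup bound on G
  obtain ⟨A₀, hA₀⟩ := hGc.bounded_above_of_compact_support hGsupp
  -- sup bound on G''
  have hG''c : Continuous (iteratedDeriv 2 G) := hG2.continuous_iteratedDeriv 2 le_rfl
  have hG''supp : HasCompactSupport (iteratedDeriv 2 G) := by
    rw [iteratedDeriv_eq_iterate]
    exact hGsupp.deriv.deriv
  obtain ⟨A₂, hA₂⟩ := hG''c.bounded_above_of_compact_support hG''supp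
  have hG2supp : HasCompactSupport fun x => G x ^ 2 := by
    refine HasCompactSupport.intro (isCompact_Icc (a := -1) (b := 1)) fun x hx => ?_
    have : G x = 0 := by
      apply hG0
      by_contra hcon
      simp only [not_or, not_le] at hcon
      exact hx ⟨hcon.1.le, hcon.2.le⟩
    simp [this]
  have hint : Integrable (fun x => G x ^ 2) :=
    (hGc.pow 2).integrable_of_hasCompactSupport hG2supp
  refine ⟨G, hG2, hG0, ⟨A₀, (abs_nonneg _).trans (hA₀ 0), fun x => ?_⟩,
    ⟨A₂, (abs_nonneg _).trans (hA₂ 0), fun x => ?_⟩, hint, ?_⟩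
  · simpa [Real.norm_eq_abs] using hA₀ x
  · simpa [Real.norm_eq_abs] using hA₂ x
  refine (integral_pos_iff_support_of_nonneg (fun x => sq_nonneg (G x)) hint).2 ?_
  have hsub : Ioo (-1) 1 ⊆ Function.support fun x => G x ^ 2 := by
    intro x hx
    have h1 : 0 < expNegInvGlue (x + 1) := expNegInvGlue.pos_of_pos (by linarith [hx.1])
    have h2 : 0 < expNegInvGlue (1 - x) := expNegInvGlue.pos_of_pos (by linarith [hx.2])
    simp only [Function.mem_support, hG_def]
    positivity
  refine lt_of_lt_of_le ?_ (measure_mono hsub)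
  rw [Real.volume_Ioo]
  exact ENNReal.ofReal_pos.2 (by norm_num)

/-! ### Scaled profiles -/

/-- **Scaled bump** `g(x) = G(κ(x − x₁))`, `κ > 0`: `C²`, supported in `[x₁ − κ⁻¹, x₁ + κ⁻¹]`,
`|g| ≤ A₀`, `|g''| ≤ κ² A₂`, `∫ g² = κ⁻¹ ∫ G²`. -/
theorem scaled_profile {G : ℝ → ℝ} (hG : ContDiff ℝ 2 G) (hG0 : ∀ x, (x ≤ -1 ∨ 1 ≤ x) → G x = 0)
    {A₀ A₂ : ℝ} (hA₀ : ∀ x, |G x| ≤ A₀) (hA₂ : ∀ x, |iteratedDeriv 2 G x| ≤ A₂)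
    (x₁ : ℝ) {κ : ℝ} (hκ : 0 < κ) :
    ContDiff ℝ 2 (fun x => G (κ * (x - x₁))) ∧
    (∀ x, (x ≤ x₁ - κ⁻¹ ∨ x₁ + κ⁻¹ ≤ x) → G (κ * (x - x₁)) = 0) ∧
    (∀ x, G (κ * (x - x₁)) ≠ 0 → |x - x₁| < κ⁻¹) ∧
    (∀ x, |G (κ * (x - x₁))| ≤ A₀) ∧
    (∀ x, |iteratedDeriv 2 (fun y => G (κ * (y - x₁))) x| ≤ κ ^ 2 * A₂) ∧
    Integrable (fun x => G (κ * (x - x₁)) ^ 2) ∧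
    ∫ x, G (κ * (x - x₁)) ^ 2 = κ⁻¹ * ∫ x, G x ^ 2 := by
  have hκ0 : κ ≠ 0 := hκ.ne'
  have hcd : ContDiff ℝ 2 (fun x => G (κ * (x - x₁))) :=
    hG.comp (contDiff_const.mul (contDiff_id.sub contDiff_const))
  -- support
  have hsupp : ∀ x, (x ≤ x₁ - κ⁻¹ ∨ x₁ + κ⁻¹ ≤ x) → G (κ * (x - x₁)) = 0 := by
    intro x hx
    apply hG0
    rcases hx with h | h
    · left
      have : κ * (x - x₁) ≤ κ * (-κ⁻¹) := mul_le_mul_of_nonneg_left (by linarith) hκ.le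
      rwa [mul_neg, mul_inv_cancel₀ hκ0] at this
    · right
      have : κ * κ⁻¹ ≤ κ * (x - x₁) := mul_le_mul_of_nonneg_left (by linarith) hκ.le
      rwa [mul_inv_cancel₀ hκ0] at this
  have hne : ∀ x, G (κ * (x - x₁)) ≠ 0 → |x - x₁| < κ⁻¹ := by
    intro x hx
    rw [abs_lt]
    by_contra hcon
    rw [not_and_or, not_lt, not_lt] at hcon
    apply hx
    apply hsupp
    rcases hcon with h | h
    · left; linarith
    · right; linarith
  -- second derivative of the scaled profile
  have hd2 : ∀ x, iteratedDeriv 2 (fun y => G (κ * (y - x₁))) x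
      = κ ^ 2 * iteratedDeriv 2 G (κ * (x - x₁)) := by
    intro x
    have h1 := iteratedDeriv_comp_sub_const 2 (fun z => G (κ * z)) x₁
    have h2 := iteratedDeriv_comp_const_mul hG κ
    change iteratedDeriv 2 (fun y => (fun z => G (κ * z)) (y - x₁)) x = _
    rw [h1]
    change iteratedDeriv 2 (fun z => G (κ * z)) (x - x₁) = _
    rw [h2]
  -- integrability and the value of ∫ g²
  have hGc : Continuous G := hG.continuous
  have hgc : Continuous fun x => G (κ * (x - x₁)) := hcd.continuous
  have hgsupp : HasCompactSupport fun x => G (κ * (x - x₁)) ^ 2 := by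
    refine HasCompactSupport.intro (isCompact_Icc (a := x₁ - κ⁻¹) (b := x₁ + κ⁻¹)) fun x hx => ?_
    have : G (κ * (x - x₁)) = 0 := by
      apply hsupp
      by_contra hcon
      simp only [not_or, not_le] at hcon
      exact hx ⟨hcon.1.le, hcon.2.le⟩
    simp [this]
  have hint : Integrable (fun x => G (κ * (x - x₁)) ^ 2) :=
    (hgc.pow 2).integrable_of_hasCompactSupport hgsupp
  have hval : ∫ x, G (κ * (x - x₁)) ^ 2 = κ⁻¹ * ∫ x, G x ^ 2 := by
    have h1 : (∫ x, G (κ * (x - x₁)) ^ 2) = ∫ x, G (κ * x) ^ 2 :=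
      integral_sub_right_eq_self (μ := (volume : Measure ℝ)) (fun x => G (κ * x) ^ 2) x₁
    rw [h1]
    have h2 := Measure.integral_comp_mul_left (fun y => G y ^ 2) κ
    rw [h2, abs_of_pos (inv_pos.2 hκ), smul_eq_mul]
  refine ⟨hcd, hsupp, hne, fun x => hA₀ _, fun x => ?_, hint, hval⟩
  rw [hd2 x, abs_mul, abs_of_pos (pow_pos hκ 2)]
  exact mul_le_mul_of_nonneg_left (hA₂ _) (pow_pos hκ 2).le

/-! ### The spin-1 Regge–Wheeler potential at `M = 1` on a compact layer -/

open Literature.Geometry.Lorentzian Literature.Geometry.Lorentzian.ReggeWheeler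

/-- At `M = 1`, `s = 1` the line potential factors as `ℓ(ℓ+1) · f` with the `ℓ`-independent shape
`f(x) = (1 − 2/r(x)) / r(x)²`. -/
theorem linePotential_one_one_eq (r : ℝ → ℝ) (ℓ : ℕ) (x : ℝ) :
    linePotential 1 1 ℓ r x = ((ℓ : ℝ) * ((ℓ : ℝ) + 1)) * ((1 - 2 / r x) / r x ^ 2) := by
  simp only [linePotential, rwPotential, Nat.cast_one]
  ring

/-- The shape `f = (1 − 2/r)/r²` is positive along a tortoise radius function (`r > 2`). -/
theorem shape_pos {r : ℝ → ℝ} {xc : ℝ} (hr : IsTortoiseRadius 1 r xc) (x : ℝ) :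
    0 < (1 - 2 / r x) / r x ^ 2 := by
  have h1 : 0 < 1 - 2 * (1 : ℝ) / r x := hr.deriv_pos x
  have h2 : 0 < r x := hr.pos x
  rw [mul_one] at h1
  positivity

/-- The shape `f = (1 − 2/r)/r²` is `C¹` along a tortoise radius function. -/
theorem contDiff_one_shape {r : ℝ → ℝ} {xc : ℝ} (hr : IsTortoiseRadius 1 r xc) :
    ContDiff ℝ 1 (fun x => (1 - 2 / r x) / r x ^ 2) := by
  have hrC : ContDiff ℝ 1 r := hr.contDiff_one
  have hr0 : ∀ x, r x ≠ 0 := fun x => (hr.pos x).ne'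
  exact (contDiff_const.sub (contDiff_const.div hrC hr0)).div (hrC.pow 2)
    fun x => pow_ne_zero 2 (hr0 x)

/-- **The shape on a compact layer**: a positive floor `f ≥ f₀ > 0` and a Lipschitz constant
`|f x − f y| ≤ K |x − y|` on `[a, b]`. -/
theorem shape_layer_bounds_of {r : ℝ → ℝ} {xc : ℝ} (hr : IsTortoiseRadius 1 r xc) {a b : ℝ}
    (hab : a ≤ b) :
    ∃ f₀ K : ℝ, 0 < f₀ ∧ 0 ≤ K ∧ (∀ x ∈ Icc a b, f₀ ≤ (1 - 2 / r x) / r x ^ 2) ∧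
      ∀ x ∈ Icc a b, ∀ y ∈ Icc a b,
        |(1 - 2 / r x) / r x ^ 2 - (1 - 2 / r y) / r y ^ 2| ≤ K * |x - y| := by
  set f : ℝ → ℝ := fun x => (1 - 2 / r x) / r x ^ 2 with hf
  have hf1 : ContDiff ℝ 1 f := contDiff_one_shape hr
  have hfc : Continuous f := hf1.continuous
  have hne : (Icc a b).Nonempty := nonempty_Icc.2 hab
  -- positive floor
  obtain ⟨xm, hxm, hmin⟩ := isCompact_Icc.exists_isMinOn hne hfc.continuousOn
  -- derivative bound on the layer
  have hf'c : Continuous (deriv f) := hf1.continuous_deriv le_rfl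
  obtain ⟨K, hK⟩ := isCompact_Icc.exists_bound_of_continuousOn (s := Icc a b) hf'c.continuousOn
  have hK0 : 0 ≤ K := (norm_nonneg _).trans (hK a (left_mem_Icc.2 hab))
  have hdiff : ∀ x ∈ Icc a b, DifferentiableAt ℝ f x := fun x _ =>
    (hf1.differentiable (by simp)) x
  refine ⟨f xm, K, shape_pos hr xm, hK0, fun x hx => hmin hx, fun x hx y hy => ?_⟩
  have h := (convex_Icc a b).norm_image_sub_le_of_norm_deriv_le hdiff hK hy hx
  rw [Real.norm_eq_abs, Real.norm_eq_abs] at h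
  exact h

/-- **Registered sub-goal `shape_layer_bounds`** (item stmt-FinalStateConjecture-10046, prover seat 0;
statement verbatim as registered): the shape of `V_{1,ℓ}` at `M = 1` has a positive floor and a
Lipschitz constant on every compact layer. -/
theorem shape_layer_bounds : ∀ {r : ℝ → ℝ} {xc : ℝ}, Literature.Geometry.Lorentzian.ReggeWheeler.IsTortoiseRadius 1 r xc → ∀ {a b : ℝ}, a ≤ b → ∃ f₀ K : ℝ, 0 < f₀ ∧ 0 ≤ K ∧ (∀ x ∈ Set.Icc a b, f₀ ≤ (1 - 2 / r x) / r x ^ 2) ∧ ∀ x ∈ Set.Icc a b, ∀ y ∈ Set.Icc a b, |(1 - 2 / r x) / r x ^ 2 - (1 - 2 / r y) / r y ^ 2| ≤ K * |x - y| :=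
  fun hr _ _ hab => shape_layer_bounds_of hr hab

end Summit.FinalStateConjecture.FinalStateConjecture.Theorems.FrozenEscape

end
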